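import Literature.Analysis.FluidPDE.ElgindiTheoremTwoClosure
import Literature.Analysis.FluidPDE.ElgindiStreamBoundary
import HarnessLib

/-!
# Closure solutions of `L_αΨ = F` are classical stream functions
([Elgindi2021] §7.5 Theorem 2 with Remark 8.3 and §7 (PolarBSL) boundary conditions)

Topic `Literature/Analysis/FluidPDE`. Proof file (everything proved, no definitions, no named
facts) on the proof path of the named fact
`Literature.Analysis.FluidPDE.Elgindi.ElgindiGhoulMasmoudi2021_stabilityCore`
(`ElgindiStabilityDecomposition.lean`). T. M. Elgindi, Ann. of Math. 194 (2021) =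
arXiv:1904.04795, §7 (p. 19: "the natural boundary conditions `Ψ(R,0) = Ψ(R,π/2) = 0`"), §7.5
Theorem 2 (p. 24) with §8.1 Remark 8.3 (p. 27).

The solution `Ψ` of `L_αΨ = F` in the closure class (`theoremTwo_of_finite_L12`) is produced as an
a.e. limit of the Theorem 2 solutions `Ψ_n` of test data `f_n → F`. We verify the hypotheses of the
boundary-continuity bridge `ElgindiStreamBoundary` for it:
* `∂_θΨ, ∂_R∂_θΨ ∈ L²((a,b) × (0,π/2))`: from `|∂_θθΨ + α⁻¹L₁₂(F) sin 2θ|_{𝓗⁴} < ∞` (radial words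
  of orders `0, 1`, the corrector being smooth in `R > 0`) by integration from `θ = π/4`
  (`integrableOn_sq_box_of_dθ`);
* `Ψ²/sin²(2θ) ∈ L¹((a,b) × (0,π/2))`: the weighted Hardy bound
  `∫∫ w²Ψ̂_n²/sin²2θ ≤ 160∫∫w²F̂_n²` of the variational solutions (`ElgindiWeightedHardy`,
  `ElgindiWeightedEnergyBound`) and the bounds on the correctors `G_n` are uniform along the
  approximating sequence, and pass to the a.e. limit by Fatou (`lintegral_box_hardy_limit_le`).
Hence `stripExt Ψ` is an `IsStreamFunction` of `F` with the Theorem 2 bounds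
(`exists_isStreamFunction_of_finite`).
-/

noncomputable section

open MeasureTheory Set Real Filter Function Finset
open _root_.Topology
open scoped ENNReal ContDiff InnerProductSpace

namespace Literature.Analysis.FluidPDE

namespace Elgindi

/-! ### Tonelli on boxes `(a,b) × (0,π/2)` -/

/-- The box measure is a product measure. [folklore] -/
theorem volume_restrict_box (a b : ℝ) :
    (volume.restrict (Ioo a b ×ˢ Ioo (0:ℝ) (π / 2)) : Measure (ℝ × ℝ)) = (volume.restrict (Ioo a b)).prod (volume.restrict (Ioo 0 (π / 2))) := by
  rw [Measure.volume_eq_prod, Measure.prod_restrict]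

/-- A box with `0 < a` lies in the strip. [folklore] -/
theorem qbox_subset_strip {a b : ℝ} (ha : 0 < a) : Ioo a b ×ˢ Ioo (0:ℝ) (π / 2) ⊆ strip := fun _ hp => ⟨ha.trans hp.1.1, hp.2⟩

/-- The box is measurable. [folklore] -/
theorem measurableSet_qbox (a b : ℝ) : MeasurableSet (Ioo a b ×ˢ Ioo (0:ℝ) (π / 2)) := measurableSet_Ioo.prod measurableSet_Ioo

/-- A function continuous on the strip, with finite `∫⁻_box ofReal(g²)`, has `g² ∈ L¹(box)`. [folklore] -/
theorem integrableOn_sq_box_of_lintegral {g : ℝ → ℝ → ℝ} (hg : ContinuousOn (uncurry g) strip) {a b : ℝ} (ha : 0 < a)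
    (hfin : ∫⁻ p in Ioo a b ×ˢ Ioo (0:ℝ) (π / 2), ENNReal.ofReal (g p.1 p.2 ^ 2) < ⊤) :
    IntegrableOn (fun p : ℝ × ℝ => g p.1 p.2 ^ 2) (Ioo a b ×ˢ Ioo 0 (π / 2)) := by
  have hc : ContinuousOn (fun p : ℝ × ℝ => g p.1 p.2 ^ 2) (Ioo a b ×ˢ Ioo 0 (π / 2)) := (hg.mono (qbox_subset_strip ha)).pow 2
  refine ⟨hc.aestronglyMeasurable (measurableSet_qbox a b), ?_⟩
  rw [hasFiniteIntegral_iff_ofReal (ae_of_all _ fun p => sq_nonneg _)]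
  exact hfin

-- (The converse, `g² ∈ L¹(box) ⇒ ∫⁻_box ofReal(g²) < ⊤`, is Mathlib's `IntegrableOn.setLIntegral_lt_top`.)

/-! ### Local square integrability from the `𝓗⁴` functional -/

/-- **`|f|_{𝓗⁴} < ∞ ⇒ f ∈ L²((a,b) × (0,π/2))`.** [folklore] -/
theorem integrableOn_sq_box_of_eHkNormSq (α : ℝ) {f : ℝ → ℝ → ℝ} (hf : ContinuousOn (uncurry f) strip) (hE : eHkNormSq α 4 f < ⊤)
    {a b : ℝ} (ha : 0 < a) : IntegrableOn (fun p : ℝ × ℝ => f p.1 p.2 ^ 2) (Ioo a b ×ˢ Ioo 0 (π / 2)) := by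
  refine integrableOn_sq_box_of_lintegral hf ha (lt_of_le_of_lt ?_ (lt_of_le_of_lt (lintegral_sq_le_eHkNormSq α f) hE))
  exact lintegral_mono_set (qbox_subset_strip ha)

/-- **`|f|_{𝓗⁴} < ∞ ⇒ ∂_Rf ∈ L²((a,b) × (0,π/2))`** (`0 < a`; the radial word of order one). [folklore] -/
theorem integrableOn_sq_dz_box_of_eHkNormSq (α : ℝ) {f : ℝ → ℝ → ℝ} (hf : ContDiffOn ℝ 1 (uncurry f) strip) (hE : eHkNormSq α 4 f < ⊤)
    {a b : ℝ} (ha : 0 < a) : IntegrableOn (fun p : ℝ × ℝ => dz f p.1 p.2 ^ 2) (Ioo a b ×ˢ Ioo 0 (π / 2)) := by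
  have hc : ContinuousOn (uncurry (dz f)) strip := (contDiffOn_dz (n := 0) (by simpa using hf)).continuousOn
  refine integrableOn_sq_box_of_lintegral hc ha ?_
  have h1 : eL2Sq (hkRadialTerm 1 f) < ⊤ := lt_of_le_of_lt (eL2Sq_hkRadialTerm_le α (show 1 ≤ 4 by norm_num) f) hE
  rw [eL2Sq_eq_lintegral_ofReal] at h1
  -- on the box `(dz f)² ≤ a⁻² (D_zf · hWeight)²`
  have hpt : ∀ p ∈ Ioo a b ×ˢ Ioo (0:ℝ) (π / 2), ENNReal.ofReal (dz f p.1 p.2 ^ 2) ≤ ENNReal.ofReal (a⁻¹ ^ 2) * ENNReal.ofReal (hkRadialTerm 1 f p.1 p.2 ^ 2) := by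
    intro p hp
    have hz : a < p.1 := hp.1.1
    have hz0 : 0 < p.1 := ha.trans hz
    have hs : 0 < Real.sin (2 * p.2) := Real.sin_pos_of_pos_of_lt_pi (by linarith [hp.2.1]) (by linarith [hp.2.2])
    have hw : 1 ≤ radialWeight p.1 := by unfold radialWeight; rw [le_div_iff₀ (by positivity)]; nlinarith
    have hsle : Real.sin (2 * p.2) ^ (eta / 2) ≤ 1 := Real.rpow_le_one hs.le (Real.sin_le_one _) (by unfold eta; norm_num)
    have hW : 1 ≤ hWeight p.1 p.2 := by
      unfold hWeight; rw [le_div_iff₀ (Real.rpow_pos_of_pos hs _)]; linarith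
    rw [← ENNReal.ofReal_mul (sq_nonneg _)]
    refine ENNReal.ofReal_le_ofReal ?_
    simp only [hkRadialTerm, Function.iterate_one, Dz_apply]
    have e : dz f p.1 p.2 = deriv (fun z' => f z' p.2) p.1 := rfl
    rw [e]
    set d := deriv (fun z' => f z' p.2) p.1
    have hza : 1 ≤ (p.1 / a) ^ 2 := one_le_pow₀ (by rw [le_div_iff₀ ha]; linarith)
    have hW2 : 1 ≤ hWeight p.1 p.2 ^ 2 := one_le_pow₀ hW
    have e2 : a⁻¹ ^ 2 * (p.1 * d * hWeight p.1 p.2) ^ 2 = d ^ 2 * ((p.1 / a) ^ 2 * hWeight p.1 p.2 ^ 2) := by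
      field_simp
    rw [e2]
    have : 1 ≤ (p.1 / a) ^ 2 * hWeight p.1 p.2 ^ 2 := one_le_mul_of_one_le_of_one_le hza hW2
    nlinarith [sq_nonneg d]
  calc ∫⁻ p in Ioo a b ×ˢ Ioo (0:ℝ) (π / 2), ENNReal.ofReal (dz f p.1 p.2 ^ 2)
      ≤ ∫⁻ p in Ioo a b ×ˢ Ioo (0:ℝ) (π / 2), ENNReal.ofReal (a⁻¹ ^ 2) * ENNReal.ofReal (hkRadialTerm 1 f p.1 p.2 ^ 2) :=
        setLIntegral_mono' (measurableSet_qbox a b) hpt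
    _ = ENNReal.ofReal (a⁻¹ ^ 2) * ∫⁻ p in Ioo a b ×ˢ Ioo (0:ℝ) (π / 2), ENNReal.ofReal (hkRadialTerm 1 f p.1 p.2 ^ 2) := by
        rw [lintegral_const_mul' _ _ ENNReal.ofReal_ne_top]
    _ ≤ ENNReal.ofReal (a⁻¹ ^ 2) * ∫⁻ p in strip, ENNReal.ofReal (hkRadialTerm 1 f p.1 p.2 ^ 2) := by
        gcongr
        · exact qbox_subset_strip ha
    _ < ⊤ := ENNReal.mul_lt_top ENNReal.ofReal_lt_top h1

/-! ### From `∂_θg ∈ L²(box)` to `g ∈ L²(box)` -/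

/-- Cauchy–Schwarz on an interval, unordered form: `(∫_c^d f)² ≤ |∫_c^d f²|` when `|d − c| ≤ 1`. [folklore] -/
theorem sq_intervalIntegral_le_abs {f : ℝ → ℝ} {c d : ℝ} (hf : ContinuousOn f (uIcc c d)) (hcd : |d - c| ≤ 1) :
    (∫ x in c..d, f x) ^ 2 ≤ |∫ x in c..d, f x ^ 2| := by
  rcases le_total c d with h | h
  · rw [uIcc_of_le h] at hf
    have h1 := sq_intervalIntegral_le_on hf h
    have h0 : 0 ≤ ∫ x in c..d, f x ^ 2 := intervalIntegral.integral_nonneg h fun x _ => sq_nonneg _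
    rw [abs_of_nonneg h0]
    rw [abs_of_nonneg (by linarith)] at hcd
    nlinarith
  · rw [uIcc_of_ge h] at hf
    have h1 := sq_intervalIntegral_le_on hf h
    have h0 : 0 ≤ ∫ x in d..c, f x ^ 2 := intervalIntegral.integral_nonneg h fun x _ => sq_nonneg _
    rw [intervalIntegral.integral_symm d c, neg_sq, intervalIntegral.integral_symm d c, abs_neg, abs_of_nonneg h0]
    rw [abs_of_nonpos (by linarith)] at hcd
    nlinarith

/-- **Integration from `θ = π/4`**: for `g` smooth on the strip with `∂_θg ∈ L²((a,b) × (0,π/2))`,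
also `g ∈ L²((a,b) × (0,π/2))`. [folklore] -/
theorem integrableOn_sq_box_of_dθ {g : ℝ → ℝ → ℝ} (hg : ContDiffOn ℝ ∞ (uncurry g) strip) {a b : ℝ} (ha : 0 < a)
    (h : IntegrableOn (fun p : ℝ × ℝ => dθ g p.1 p.2 ^ 2) (Ioo a b ×ˢ Ioo 0 (π / 2))) :
    IntegrableOn (fun p : ℝ × ℝ => g p.1 p.2 ^ 2) (Ioo a b ×ˢ Ioo 0 (π / 2)) := by
  have hπ4 : (π / 4 : ℝ) ∈ Ioo 0 (π / 2) := ⟨by positivity, by linarith [Real.pi_pos]⟩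
  have hg1 : ContDiffOn ℝ 1 (uncurry g) strip := contDiffOn_infty.1 hg 1
  have hGc : ContinuousOn (uncurry (dθ g)) strip := (contDiffOn_dθ (n := 0) (by simpa using hg1)).continuousOn
  set μ : Measure ℝ := volume.restrict (Ioo a b) with hμ
  set ν : Measure ℝ := volume.restrict (Ioo (0:ℝ) (π / 2)) with hν
  -- the integrand `G = ofReal((∂_θg)²)` and the slice functional `Λ`
  set G : ℝ × ℝ → ℝ≥0∞ := fun p => ENNReal.ofReal (dθ g p.1 p.2 ^ 2) with hGdef
  have hGm : AEMeasurable G (μ.prod ν) := by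
    rw [hμ, hν, ← volume_restrict_box]
    exact (ENNReal.measurable_ofReal.comp_aemeasurable
      (((hGc.mono (qbox_subset_strip ha)).pow 2).aemeasurable (measurableSet_qbox a b)))
  have hGfin : ∫⁻ p, G p ∂(μ.prod ν) < ⊤ := by
    rw [hμ, hν, ← volume_restrict_box]; exact h.setLIntegral_lt_top
  set Λ : ℝ → ℝ≥0∞ := fun z => ∫⁻ t, G (z, t) ∂ν with hΛdef
  have hΛm : AEMeasurable Λ μ := hGm.lintegral_prod_right'
  have hΛint : ∫⁻ z, Λ z ∂μ = ∫⁻ p, G p ∂(μ.prod ν) := (lintegral_prod _ hGm).symm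
  -- the pointwise bound on the box
  have hpt : ∀ p ∈ Ioo a b ×ˢ Ioo (0:ℝ) (π / 2), ENNReal.ofReal (g p.1 p.2 ^ 2) ≤ ENNReal.ofReal (2 * g p.1 (π / 4) ^ 2) + 2 * Λ p.1 := by
    intro p hp
    have hz : 0 < p.1 := ha.trans hp.1.1
    have hθ : p.2 ∈ Ioo (0:ℝ) (π / 2) := hp.2
    -- FTC between `π/4` and `p.2`
    have hsub : uIcc (π / 4) p.2 ⊆ Ioo 0 (π / 2) := by
      rcases le_total (π / 4) p.2 with hle | hle
      · rw [uIcc_of_le hle]; exact fun t ht => ⟨hπ4.1.trans_le ht.1, ht.2.trans_lt hθ.2⟩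
      · rw [uIcc_of_ge hle]; exact fun t ht => ⟨hθ.1.trans_le ht.1, ht.2.trans_lt hπ4.2⟩
    have hcf : ContinuousOn (fun t => dθ g p.1 t) (uIcc (π / 4) p.2) := (continuousOn_dθ_thetaSlice hg hz).mono hsub
    have hftc : g p.1 p.2 - g p.1 (π / 4) = ∫ t in (π / 4)..p.2, dθ g p.1 t := by
      have := intervalIntegral.integral_eq_sub_of_hasDerivAt (f := fun t => g p.1 t) (f' := fun t => dθ g p.1 t) (a := π / 4) (b := p.2)
        (fun t ht => hasDerivAt_thetaSlice hg hz (hsub ht)) (hcf.intervalIntegrable)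
      exact this.symm
    have hlen : |p.2 - π / 4| ≤ 1 := by
      rw [abs_le]; constructor <;> nlinarith [hθ.1, hθ.2, Real.pi_gt_three, Real.pi_lt_d2]
    have hCS := sq_intervalIntegral_le_abs hcf hlen
    -- the interval integral of the square against `Λ`
    have hI : ENNReal.ofReal |∫ t in (π / 4)..p.2, dθ g p.1 t ^ 2| ≤ Λ p.1 := by
      have key : ∀ {c d : ℝ}, c ≤ d → Icc c d ⊆ Ioo 0 (π / 2) → ContinuousOn (fun t => dθ g p.1 t) (Icc c d) →
          ENNReal.ofReal (∫ t in c..d, dθ g p.1 t ^ 2) ≤ Λ p.1 := by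
        intro c d hcd hcds hc
        have hi : IntegrableOn (fun t => dθ g p.1 t ^ 2) (Ioc c d) := ((hc.pow 2).integrableOn_Icc).mono_set Ioc_subset_Icc_self
        rw [intervalIntegral.integral_of_le hcd, ofReal_integral_eq_lintegral_ofReal hi (ae_of_all _ fun t => sq_nonneg _)]
        calc ∫⁻ t in Ioc c d, ENNReal.ofReal (dθ g p.1 t ^ 2) ≤ ∫⁻ t in Ioo 0 (π / 2), ENNReal.ofReal (dθ g p.1 t ^ 2) :=
              lintegral_mono_set fun t ht => hcds ⟨ht.1.le, ht.2⟩
          _ = Λ p.1 := rfl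
      rcases le_total (π / 4) p.2 with hle | hle
      · have hI0 : 0 ≤ ∫ t in (π / 4)..p.2, dθ g p.1 t ^ 2 := intervalIntegral.integral_nonneg hle fun t _ => sq_nonneg _
        rw [abs_of_nonneg hI0]
        rw [uIcc_of_le hle] at hsub hcf
        exact key hle hsub hcf
      · rw [intervalIntegral.integral_symm, abs_neg]
        have hI0 : 0 ≤ ∫ t in p.2..(π / 4), dθ g p.1 t ^ 2 := intervalIntegral.integral_nonneg hle fun t _ => sq_nonneg _
        rw [abs_of_nonneg hI0]
        rw [uIcc_of_ge hle] at hsub hcf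
        exact key hle hsub hcf
    -- assemble
    have e1 : g p.1 p.2 = g p.1 (π / 4) + ∫ t in (π / 4)..p.2, dθ g p.1 t := by linarith
    have hsq : g p.1 p.2 ^ 2 ≤ 2 * g p.1 (π / 4) ^ 2 + 2 * |∫ t in (π / 4)..p.2, dθ g p.1 t ^ 2| := by
      rw [e1]
      nlinarith [sq_nonneg (g p.1 (π / 4) - ∫ t in (π / 4)..p.2, dθ g p.1 t), hCS, abs_nonneg (∫ t in (π / 4)..p.2, dθ g p.1 t ^ 2)]
    calc ENNReal.ofReal (g p.1 p.2 ^ 2) ≤ ENNReal.ofReal (2 * g p.1 (π / 4) ^ 2 + 2 * |∫ t in (π / 4)..p.2, dθ g p.1 t ^ 2|) :=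
          ENNReal.ofReal_le_ofReal hsq
      _ = ENNReal.ofReal (2 * g p.1 (π / 4) ^ 2) + 2 * ENNReal.ofReal |∫ t in (π / 4)..p.2, dθ g p.1 t ^ 2| := by
          rw [ENNReal.ofReal_add (by positivity) (by positivity)]
          congr 1
          rw [ENNReal.ofReal_mul (by norm_num), ENNReal.ofReal_ofNat]
      _ ≤ ENNReal.ofReal (2 * g p.1 (π / 4) ^ 2) + 2 * Λ p.1 := by gcongr
  -- the bound `g(·,π/4)² ≤ B` on `[a,b]`
  obtain ⟨B, hB⟩ : ∃ B, ∀ z ∈ Icc a b, 2 * g z (π / 4) ^ 2 ≤ B := by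
    have hc : ContinuousOn (fun z => 2 * g z (π / 4) ^ 2) (Icc a b) := ((continuousOn_radial_slice hg1 ha hπ4).pow 2).const_smul (2:ℝ) |>.congr fun z _ => by simp [smul_eq_mul]
    obtain ⟨B, hB⟩ := isCompact_Icc.exists_bound_of_continuousOn hc
    exact ⟨B, fun z hz => (le_abs_self _).trans (by simpa [Real.norm_eq_abs] using hB z hz)⟩
  -- finiteness of the lintegral over the box
  refine integrableOn_sq_box_of_lintegral hg.continuousOn ha ?_
  have hvol : volume (Ioo a b ×ˢ Ioo (0:ℝ) (π / 2)) < ⊤ := by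
    rw [Measure.volume_eq_prod, Measure.prod_prod, Real.volume_Ioo, Real.volume_Ioo]
    exact ENNReal.mul_lt_top ENNReal.ofReal_lt_top ENNReal.ofReal_lt_top
  calc ∫⁻ p in Ioo a b ×ˢ Ioo (0:ℝ) (π / 2), ENNReal.ofReal (g p.1 p.2 ^ 2)
      ≤ ∫⁻ p in Ioo a b ×ˢ Ioo (0:ℝ) (π / 2), (ENNReal.ofReal B + 2 * Λ p.1) := by
        refine setLIntegral_mono' (measurableSet_qbox a b) fun p hp => (hpt p hp).trans ?_
        exact add_le_add (ENNReal.ofReal_le_ofReal (hB p.1 (Ioo_subset_Icc_self hp.1))) le_rfl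
    _ = ∫⁻ p, (ENNReal.ofReal B + 2 * Λ p.1) ∂(μ.prod ν) := by rw [hμ, hν, ← volume_restrict_box]
    _ = (∫⁻ _p, ENNReal.ofReal B ∂(μ.prod ν)) + 2 * ∫⁻ p, Λ p.1 ∂(μ.prod ν) := by
        rw [lintegral_add_left' aemeasurable_const, lintegral_const_mul'' _ (hΛm.comp_fst)]
    _ < ⊤ := by
        refine ENNReal.add_lt_top.2 ⟨?_, ENNReal.mul_lt_top (by norm_num) ?_⟩
        · rw [lintegral_const, hμ, hν, ← volume_restrict_box, Measure.restrict_apply_univ]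
          exact ENNReal.mul_lt_top ENNReal.ofReal_lt_top hvol
        · rw [lintegral_prod _ (hΛm.comp_fst)]
          simp only
          have e : ∫⁻ z, ∫⁻ _t, Λ z ∂ν ∂μ = ∫⁻ z, Λ z * ν univ ∂μ := by
            refine lintegral_congr fun z => ?_
            rw [lintegral_const]
          rw [e, lintegral_mul_const'' _ hΛm, hΛint]
          refine ENNReal.mul_lt_top hGfin ?_
          rw [hν, Measure.restrict_apply_univ, Real.volume_Ioo]; exact ENNReal.ofReal_lt_top

/-! ### The weighted Hardy bound of the variational solutions -/

/-- **`∫∫ w²Ψ̂²/sin²(2θ) ≤ 160·∫∫ w²f²`** for the variational solution `Ψ̂` of `L_αΨ̂ = f`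
(Hardy bound on the energy space and the weighted energy bound). [cite: Elgindi2021, §7.1 Proposition 7.1 and §7.2 Lemma 7.2 (pp. 19–20 of arXiv:1904.04795)] -/
theorem SolData.lintegral_hardy_le {α : ℝ} {f : ℝ → ℝ → ℝ} {U : ℕ → E4} {Ψr : ℝ × ℝ → ℝ} (hS : SolData α f U Ψr) :
    ∫⁻ p in strip, ENNReal.ofReal (radialWeight p.1 ^ 2 * (Ψr p ^ 2 / Real.sin (2 * p.2) ^ 2)) ≤
      ENNReal.ofReal 160 * eHkNormSq α 4 f := by
  have hF := integrableOn_weighted_datum hS.fn hS.fs hS.fpos 0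
  have hWE := weightedEnergy_le hS.pos hS.le4 (hS.sol 0).mem (hS.sol 0).eq hF 2
  have hH := lintegral_weightedHardy_weakSpace (hS.sol 0).mem hWE.1
  have hae0 := weakSol_zero_ae_eq hS.pos hS.le1 hS.fn hS.fs hS.sol hS.smooth hS.ae 0
  -- replace `U₀` by `Ψ̂`
  have e1 : ∫⁻ p in strip, ENNReal.ofReal (radialWeight p.1 ^ 2 * (Ψr p ^ 2 / Real.sin (2 * p.2) ^ 2)) =
      ∫⁻ p in strip, ENNReal.ofReal (radialWeight p.1 ^ 2 * ((U 0 0 : ℝ × ℝ → ℝ) p ^ 2 / Real.sin (2 * p.2) ^ 2)) := by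
    refine lintegral_congr_ae ?_
    filter_upwards [(ae_restrict_iff' measurableSet_strip).2 hae0] with y hy
    rw [hy]; simp
  rw [e1]
  refine hH.trans ?_
  -- `∫ w²U₂² ≤ 16 ∫ w²(toL2 f)² = 16 ∫ w² f² ≤ 16 |f|²`
  have hfc : Continuous (uncurry f) := (hS.fn 0).continuous
  have hmem : MemLp (fun p : ℝ × ℝ => (Dz^[0] f) p.1 p.2) 2 stripMeasure := by
    have e : (fun p : ℝ × ℝ => (Dz^[0] f) p.1 p.2) = uncurry f := by funext p; rfl
    rw [e]; exact memLp_strip_of_continuous hfc hS.fs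
  have e2 : ∫ p in strip, radialWeight p.1 ^ 2 * (toL2 (fun p : ℝ × ℝ => (Dz^[0] f) p.1 p.2) : ℝ × ℝ → ℝ) p ^ 2 =
      ∫ p in strip, radialWeight p.1 ^ 2 * f p.1 p.2 ^ 2 := by
    refine integral_congr_ae ?_
    filter_upwards [toL2_ae_eq' hmem] with p hp
    rw [hp]; simp
  have hF' : IntegrableOn (fun p : ℝ × ℝ => radialWeight p.1 ^ 2 * f p.1 p.2 ^ 2) strip := by
    refine hF.congr ?_
    filter_upwards [toL2_ae_eq' hmem] with p hp
    rw [hp]; simp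
  have e3 : ENNReal.ofReal (∫ p in strip, radialWeight p.1 ^ 2 * f p.1 p.2 ^ 2) ≤ eHkNormSq α 4 f := by
    rw [ofReal_integral_eq_lintegral_ofReal hF' (ae_of_all _ fun p => by positivity)]
    refine le_trans ?_ (eL2Sq_hkRadialTerm_le α (show 0 ≤ 4 by norm_num) f)
    rw [eL2Sq_eq_lintegral_ofReal]
    refine setLIntegral_mono' measurableSet_strip fun p hp => ENNReal.ofReal_le_ofReal ?_
    have hs : 0 < Real.sin (2 * p.2) := Real.sin_pos_of_pos_of_lt_pi (by linarith [hp.2.1]) (by linarith [hp.2.2])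
    have hsle : Real.sin (2 * p.2) ^ (eta / 2) ≤ 1 := Real.rpow_le_one hs.le (Real.sin_le_one _) (by unfold eta; norm_num)
    have hw0 : 0 ≤ radialWeight p.1 := by unfold radialWeight; positivity
    have hW : radialWeight p.1 ≤ hWeight p.1 p.2 := by
      unfold hWeight; rw [le_div_iff₀ (Real.rpow_pos_of_pos hs _)]; nlinarith
    simp only [hkRadialTerm, Function.iterate_zero, id_eq]
    calc radialWeight p.1 ^ 2 * f p.1 p.2 ^ 2 = (f p.1 p.2 * radialWeight p.1) ^ 2 := by ring
      _ ≤ (f p.1 p.2 * hWeight p.1 p.2) ^ 2 := by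
          rw [mul_pow, mul_pow]; exact mul_le_mul_of_nonneg_left (pow_le_pow_left₀ hw0 hW 2) (sq_nonneg _)
  calc ENNReal.ofReal (10 * ∫ p in strip, radialWeight p.1 ^ 2 * (U 0 2 : ℝ × ℝ → ℝ) p ^ 2)
      ≤ ENNReal.ofReal (160 * ∫ p in strip, radialWeight p.1 ^ 2 * f p.1 p.2 ^ 2) := by
        refine ENNReal.ofReal_le_ofReal ?_
        have := hWE.2; rw [e2] at this; linarith
    _ = ENNReal.ofReal 160 * ENNReal.ofReal (∫ p in strip, radialWeight p.1 ^ 2 * f p.1 p.2 ^ 2) := by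
        rw [← ENNReal.ofReal_mul (by norm_num)]
    _ ≤ ENNReal.ofReal 160 * eHkNormSq α 4 f := by gcongr

/-! ### The local Hardy bound of the Theorem 2 solutions of test data -/

/-- `(radialEnergy 0 (kMoment F))` controls `L₁₂(F)²` pointwise: `ofReal(L₁₂(F)(R)²) ≤ 2·A₀(kMoment F)`. [folklore] -/
theorem NiceDatum.ofReal_sq_L12_le {F : ℝ → ℝ → ℝ} (hF : NiceDatum F) (R : ℝ) :
    ENNReal.ofReal (L12 F R ^ 2) ≤ 2 * radialEnergy 0 (kMoment F) := by
  have h := abs_L12_le (hF.smooth 0) hF.supp hF.sub R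
  have e : ENNReal.ofReal (L12 F R ^ 2) = ENNReal.ofReal |L12 F R| ^ 2 := by
    rw [← sq_abs, ENNReal.ofReal_pow (abs_nonneg _)]
  rw [e]
  calc ENNReal.ofReal |L12 F R| ^ 2 ≤ (ENNReal.ofReal (Real.sqrt 2) * radialEnergy 0 (kMoment F) ^ (1 / 2 : ℝ)) ^ 2 :=
        pow_le_pow_left' h 2
    _ = ENNReal.ofReal (Real.sqrt 2) ^ 2 * (radialEnergy 0 (kMoment F) ^ (1 / 2 : ℝ)) ^ 2 := mul_pow _ _ _
    _ = 2 * radialEnergy 0 (kMoment F) := by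
        congr 1
        · rw [← ENNReal.ofReal_pow (Real.sqrt_nonneg _), Real.sq_sqrt (by norm_num), ENNReal.ofReal_ofNat]
        · rw [← ENNReal.rpow_natCast, ← ENNReal.rpow_mul]; norm_num

/-- **The local Hardy bound of `Ψ_f = Ψ̂ − G ⊗ sin 2θ`** on `Q = (a,b) × (0,π/2)`, `0 < a`:
`∫∫_Q Ψ_f²/sin²(2θ) ≤ 320|F̂|²_{𝓗⁴} + 4·vol(Q)·(4α)⁻²·2A₀(kMoment f) + 2π·A₀(Ḡ)`. [cite: Elgindi2021, §7.5 (p. 24 of arXiv:1904.04795)] -/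
theorem lintegral_box_hardy_thmTwoSol_le {α : ℝ} {f : ℝ → ℝ → ℝ} (hf : NiceDatum f) {U : ℕ → E4} {Ψr : ℝ × ℝ → ℝ}
    (hS : SolData α (Fhat f) U Ψr) {a b : ℝ} (ha : 0 < a) :
    ∫⁻ p in Ioo a b ×ˢ Ioo (0:ℝ) (π / 2), ENNReal.ofReal (thmTwoSol α f Ψr p.1 p.2 ^ 2 / Real.sin (2 * p.2) ^ 2) ≤
      2 * (ENNReal.ofReal 160 * eHkNormSq α 4 (Fhat f)) +
        4 * (ENNReal.ofReal ((4 * α) ^ 2)⁻¹ * (2 * radialEnergy 0 (kMoment f)) * volume (Ioo a b ×ˢ Ioo (0:ℝ) (π / 2))) +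
        4 * (radialEnergy 0 (Gbar α f) * volume (Ioo (0:ℝ) (π / 2))) := by
  have hα : 0 < α := hS.pos
  set Q := Ioo a b ×ˢ Ioo (0:ℝ) (π / 2) with hQ
  set A : ℝ × ℝ → ℝ≥0∞ := fun p => ENNReal.ofReal (radialWeight p.1 ^ 2 * (Ψr p ^ 2 / Real.sin (2 * p.2) ^ 2)) with hA
  set S : ℝ × ℝ → ℝ≥0∞ := fun p => ENNReal.ofReal (Gstar α f p.1 ^ 2) with hSdef
  set B : ℝ × ℝ → ℝ≥0∞ := fun p => ENNReal.ofReal (radialWeight p.1 ^ 2 * Gbar α f p.1 ^ 2) with hB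
  -- pointwise splitting
  have hpt : ∀ p ∈ Q, ENNReal.ofReal (thmTwoSol α f Ψr p.1 p.2 ^ 2 / Real.sin (2 * p.2) ^ 2) ≤ 2 * A p + (4 * S p + 4 * B p) := by
    intro p hp
    have hz : 0 < p.1 := ha.trans hp.1.1
    have hs : 0 < Real.sin (2 * p.2) := Real.sin_pos_of_pos_of_lt_pi (by linarith [hp.2.1]) (by linarith [hp.2.2])
    have hw : 1 ≤ radialWeight p.1 := by unfold radialWeight; rw [le_div_iff₀ (by positivity)]; nlinarith
    have e : thmTwoSol α f Ψr p.1 p.2 = Ψr p - (Gstar α f p.1 + Gbar α f p.1) * Real.sin (2 * p.2) := by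
      simp only [thmTwoSol, Pi.sub_apply, tensor_apply, Gcor, sin2]
    simp only [hA, hSdef, hB]
    rw [e, ← ENNReal.ofReal_ofNat 2, ← ENNReal.ofReal_ofNat 4, ← ENNReal.ofReal_mul (by norm_num), ← ENNReal.ofReal_mul (by norm_num),
      ← ENNReal.ofReal_mul (by norm_num), ← ENNReal.ofReal_add (by positivity) (by positivity), ← ENNReal.ofReal_add (by positivity) (by positivity)]
    refine ENNReal.ofReal_le_ofReal ?_
    rw [div_le_iff₀ (by positivity)]
    have hw1 : 0 ≤ radialWeight p.1 ^ 2 - 1 := by nlinarith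
    have hs1 : Real.sin (2 * p.2) ^ 2 ≤ 1 := by nlinarith [Real.sin_le_one (2 * p.2), Real.neg_one_le_sin (2 * p.2)]
    have hsplit : (2 * (radialWeight p.1 ^ 2 * (Ψr p ^ 2 / Real.sin (2 * p.2) ^ 2)) +
        (4 * Gstar α f p.1 ^ 2 + 4 * (radialWeight p.1 ^ 2 * Gbar α f p.1 ^ 2))) * Real.sin (2 * p.2) ^ 2 =
        2 * radialWeight p.1 ^ 2 * Ψr p ^ 2 + (4 * Gstar α f p.1 ^ 2 + 4 * radialWeight p.1 ^ 2 * Gbar α f p.1 ^ 2) * Real.sin (2 * p.2) ^ 2 := by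
      field_simp
    rw [hsplit]
    nlinarith [sq_nonneg (Ψr p + (Gstar α f p.1 + Gbar α f p.1) * Real.sin (2 * p.2)),
      sq_nonneg ((Gstar α f p.1 - Gbar α f p.1) * Real.sin (2 * p.2)),
      mul_nonneg hw1 (sq_nonneg (Ψr p)), mul_nonneg (mul_nonneg hw1 (sq_nonneg (Gbar α f p.1))) (sq_nonneg (Real.sin (2 * p.2))),
      sq_nonneg (Gstar α f p.1), sq_nonneg (Gbar α f p.1), hs1, sq_nonneg (Real.sin (2 * p.2))]
  have hQm : MeasurableSet Q := measurableSet_qbox a b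
  have hQs : Q ⊆ strip := qbox_subset_strip ha
  -- measurability of the pieces on `Q`
  have hwc : ContinuousOn (fun z : ℝ => radialWeight z) (Ioi 0) := (contDiffOn_radialWeight_Ioi (n := 0)).continuousOn
  have hAc : ContinuousOn (fun p : ℝ × ℝ => radialWeight p.1 ^ 2 * (Ψr p ^ 2 / Real.sin (2 * p.2) ^ 2)) Q := by
    refine ContinuousOn.mul ((hwc.comp continuousOn_fst fun p hp => (hQs hp).1).pow 2) ?_
    refine ContinuousOn.div ((hS.smooth.continuousOn.mono hQs).pow 2) (by fun_prop) fun p hp => ?_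
    exact pow_ne_zero 2 (Real.sin_pos_of_pos_of_lt_pi (by linarith [hp.2.1]) (by linarith [hp.2.2])).ne'
  have mA : AEMeasurable A (volume.restrict Q) := ENNReal.measurable_ofReal.comp_aemeasurable (hAc.aemeasurable hQm)
  have hSc : Continuous fun p : ℝ × ℝ => Gstar α f p.1 ^ 2 := by
    have hc : Continuous (Gstar α f) := by
      unfold Gstar; exact continuous_const.mul (continuous_L12 (hf.smooth 0).continuous hf.supp hf.sub)
    fun_prop
  have mS : AEMeasurable S (volume.restrict Q) := (ENNReal.measurable_ofReal.comp hSc.measurable).aemeasurable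
  have hBc1 : ContinuousOn (fun z : ℝ => radialWeight z ^ 2 * Gbar α f z ^ 2) (Ioi 0) := (hwc.pow 2).mul ((hf.contDiffOn_Gbar 0).continuousOn.pow 2)
  have hBc : ContinuousOn (fun p : ℝ × ℝ => radialWeight p.1 ^ 2 * Gbar α f p.1 ^ 2) Q := hBc1.comp continuousOn_fst fun p hp => (hQs hp).1
  have mB : AEMeasurable B (volume.restrict Q) := ENNReal.measurable_ofReal.comp_aemeasurable (hBc.aemeasurable hQm)
  -- the three integrals
  have iA : ∫⁻ p in Q, A p ≤ ENNReal.ofReal 160 * eHkNormSq α 4 (Fhat f) := (lintegral_mono_set hQs).trans hS.lintegral_hardy_le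
  have iS : ∫⁻ p in Q, S p ≤ ENNReal.ofReal ((4 * α) ^ 2)⁻¹ * (2 * radialEnergy 0 (kMoment f)) * volume Q := by
    have hle : ∀ p ∈ Q, S p ≤ ENNReal.ofReal ((4 * α) ^ 2)⁻¹ * (2 * radialEnergy 0 (kMoment f)) := by
      intro p _
      simp only [hSdef, Gstar]
      rw [show (-(1 / (4 * α)) * L12 f p.1) ^ 2 = ((4 * α) ^ 2)⁻¹ * L12 f p.1 ^ 2 by field_simp, ENNReal.ofReal_mul (by positivity)]
      exact mul_le_mul' le_rfl (hf.ofReal_sq_L12_le p.1)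
    calc ∫⁻ p in Q, S p ≤ ∫⁻ _p in Q, ENNReal.ofReal ((4 * α) ^ 2)⁻¹ * (2 * radialEnergy 0 (kMoment f)) := setLIntegral_mono' hQm hle
      _ = _ := by rw [setLIntegral_const]
  have iB : ∫⁻ p in Q, B p ≤ radialEnergy 0 (Gbar α f) * volume (Ioo (0:ℝ) (π / 2)) := by
    have mB' : AEMeasurable B ((volume.restrict (Ioo a b)).prod (volume.restrict (Ioo (0:ℝ) (π / 2)))) := by
      rw [← volume_restrict_box]; exact mB
    have e1 : ∫⁻ p in Q, B p = ∫⁻ z in Ioo a b, ∫⁻ _t in Ioo (0:ℝ) (π / 2), B (z, 0) := by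
      rw [hQ, volume_restrict_box, lintegral_prod _ mB']
    rw [e1]
    have e2 : ∀ z, ∫⁻ _t in Ioo (0:ℝ) (π / 2), B (z, 0) = B (z, 0) * volume (Ioo (0:ℝ) (π / 2)) := fun z => by
      rw [setLIntegral_const, mul_comm]
    simp_rw [e2]
    rw [lintegral_mul_const'' _ ?_]
    · refine mul_le_mul' ?_ le_rfl
      calc ∫⁻ z in Ioo a b, B (z, 0) ≤ ∫⁻ z in Ioi 0, B (z, 0) := lintegral_mono_set fun z hz => ha.trans hz.1
        _ = radialEnergy 0 (Gbar α f) := by simp only [hB, radialEnergy, Function.iterate_zero, id_eq]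
    · exact ENNReal.measurable_ofReal.comp_aemeasurable ((hBc1.mono fun z hz => ha.trans hz.1).aemeasurable measurableSet_Ioo)
  -- assemble
  have m2A : AEMeasurable (fun p => 2 * A p) (volume.restrict Q) := mA.const_mul _
  have m4S : AEMeasurable (fun p => 4 * S p) (volume.restrict Q) := mS.const_mul _
  calc ∫⁻ p in Q, ENNReal.ofReal (thmTwoSol α f Ψr p.1 p.2 ^ 2 / Real.sin (2 * p.2) ^ 2)
      ≤ ∫⁻ p in Q, (2 * A p + (4 * S p + 4 * B p)) := setLIntegral_mono' hQm hpt
    _ = (2 * ∫⁻ p in Q, A p) + ((4 * ∫⁻ p in Q, S p) + 4 * ∫⁻ p in Q, B p) := by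
        rw [lintegral_add_left' m2A, lintegral_add_left' m4S, lintegral_const_mul'' _ mA, lintegral_const_mul'' _ mS, lintegral_const_mul'' _ mB]
    _ ≤ 2 * (ENNReal.ofReal 160 * eHkNormSq α 4 (Fhat f)) +
        ((4 * (ENNReal.ofReal ((4 * α) ^ 2)⁻¹ * (2 * radialEnergy 0 (kMoment f)) * volume Q)) + 4 * (radialEnergy 0 (Gbar α f) * volume (Ioo (0:ℝ) (π / 2)))) :=
        add_le_add (mul_le_mul' le_rfl iA) (add_le_add (mul_le_mul' le_rfl iS) (mul_le_mul' le_rfl iB))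
    _ = _ := by rw [add_assoc]

/-! ### Fatou: the local Hardy bound passes to a.e. limits -/

/-- **The local Hardy bound is inherited by a.e. limits.** [folklore] -/
theorem lintegral_box_hardy_limit_le {Ψs : ℕ → ℝ → ℝ → ℝ} {Ψ : ℝ × ℝ → ℝ}
    (hcont : ∀ n, ContinuousOn (uncurry (Ψs n)) strip)
    (hae : ∀ᵐ p ∂(volume.restrict strip), Tendsto (fun n => Ψs n p.1 p.2) atTop (𝓝 (Ψ p)))
    {a b : ℝ} (ha : 0 < a) {C : ℝ≥0∞}
    (hC : ∀ n, ∫⁻ p in Ioo a b ×ˢ Ioo (0:ℝ) (π / 2), ENNReal.ofReal (Ψs n p.1 p.2 ^ 2 / Real.sin (2 * p.2) ^ 2) ≤ C) :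
    ∫⁻ p in Ioo a b ×ˢ Ioo (0:ℝ) (π / 2), ENNReal.ofReal (Ψ p ^ 2 / Real.sin (2 * p.2) ^ 2) ≤ C := by
  have hQs : Ioo a b ×ˢ Ioo (0:ℝ) (π / 2) ⊆ strip := qbox_subset_strip ha
  have hQm : MeasurableSet (Ioo a b ×ˢ Ioo (0:ℝ) (π / 2)) := measurableSet_qbox a b
  have hae' : ∀ᵐ p ∂(volume.restrict (Ioo a b ×ˢ Ioo (0:ℝ) (π / 2))), Tendsto (fun n => Ψs n p.1 p.2) atTop (𝓝 (Ψ p)) :=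
    ae_restrict_of_ae_restrict_of_subset hQs hae
  have hlim : ∀ᵐ p ∂(volume.restrict (Ioo a b ×ˢ Ioo (0:ℝ) (π / 2))), ENNReal.ofReal (Ψ p ^ 2 / Real.sin (2 * p.2) ^ 2) =
      liminf (fun n => ENNReal.ofReal (Ψs n p.1 p.2 ^ 2 / Real.sin (2 * p.2) ^ 2)) atTop := by
    filter_upwards [hae'] with p hp
    have ht : Tendsto (fun n => ENNReal.ofReal (Ψs n p.1 p.2 ^ 2 / Real.sin (2 * p.2) ^ 2)) atTop (𝓝 (ENNReal.ofReal (Ψ p ^ 2 / Real.sin (2 * p.2) ^ 2))) :=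
      ENNReal.tendsto_ofReal ((hp.pow 2).div_const _)
    exact ht.liminf_eq.symm
  rw [lintegral_congr_ae hlim]
  have hm : ∀ n, AEMeasurable (fun p : ℝ × ℝ => ENNReal.ofReal (Ψs n p.1 p.2 ^ 2 / Real.sin (2 * p.2) ^ 2)) (volume.restrict (Ioo a b ×ˢ Ioo (0:ℝ) (π / 2))) := by
    intro n
    have hc : ContinuousOn (fun p : ℝ × ℝ => Ψs n p.1 p.2 ^ 2 / Real.sin (2 * p.2) ^ 2) (Ioo a b ×ˢ Ioo (0:ℝ) (π / 2)) := by
      refine ContinuousOn.div (((hcont n).mono hQs).pow 2) (by fun_prop) fun p hp => ?_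
      exact pow_ne_zero 2 (Real.sin_pos_of_pos_of_lt_pi (by linarith [hp.2.1]) (by linarith [hp.2.2])).ne'
    exact ENNReal.measurable_ofReal.comp_aemeasurable (hc.aemeasurable hQm)
  refine (lintegral_liminf_le' hm).trans ?_
  exact Filter.liminf_le_of_frequently_le' ((Eventually.of_forall hC).frequently)

/-! ### The limit along a fast approximating sequence, with a.e. convergence -/

/-- **The limit data together with the a.e. convergence of the approximating solutions.** [folklore] -/
theorem exists_thmTwoLimit_ae {α : ℝ} {F : ℝ → ℝ → ℝ} {fs : ℕ → ℝ → ℝ → ℝ} (hA : HkApprox α F fs)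
    {U : ℕ → ℕ → E4} {Ψr : ℕ → ℝ × ℝ → ℝ} (hS : ∀ n, SolData α (Fhat (fs n)) (U n) (Ψr n))
    (hfast : ∀ n, eHkNormSq α 4 (fs n - F) ≤ ((2:ℝ≥0∞)⁻¹ ^ n) ^ 2) :
    ∃ (Ψ : ℝ × ℝ → ℝ) (G : ℕ → ℝ → ℝ), ThmTwoLimit α F fs U Ψr Ψ G ∧
      ∀ᵐ p ∂(volume.restrict strip), Tendsto (fun n => thmTwoSol α (fs n) (Ψr n) p.1 p.2) atTop (𝓝 (Ψ p)) := by
  obtain ⟨Ψ, hΨs, hΨeq, hae, hL1⟩ := exists_solution_of_fast hA hS hfast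
  obtain ⟨G, hTU, hTLU, hcontG, -, c0, key⟩ := hA.exists_corrector_limit
  have hα : 0 < α := (hS 0).pos
  have hα4 : α ≤ 1 / 4 := (hS 0).le4
  have hN : ∀ n, NiceDatum (fs n) := fun n => (hA.test n).niceDatum
  have hT := fun n => theoremTwo_solData hα hα4 (hN n) (hS n)
  have hΨm : AEStronglyMeasurable Ψ (volume.restrict strip) := hΨs.continuousOn.aestronglyMeasurable measurableSet_strip
  have hv : ∀ n, AEStronglyMeasurable (fun p : ℝ × ℝ => thmTwoSol α (fs n) (Ψr n) p.1 p.2 - Ψ p) (volume.restrict strip) :=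
    fun n => ((hT n).1.continuousOn.aestronglyMeasurable measurableSet_strip).sub hΨm
  exact ⟨Ψ, G, ⟨hA, hS, hfast, hΨs, hΨeq, fun K hKs hK => tendsto_setIntegral_abs_of_weighted hv hL1 hK hKs, hTU, hTLU, hcontG, c0, key⟩, hae⟩

/-- **Uniform `𝓗⁴` bound along a fast approximating sequence**: `|f_n|² ≤ 2|F|² + 2`. [folklore] -/
theorem eHkNormSq_fast_le {α : ℝ} {F : ℝ → ℝ → ℝ} {fs : ℕ → ℝ → ℝ → ℝ} (hA : HkApprox α F fs)
    (hfast : ∀ n, eHkNormSq α 4 (fs n - F) ≤ ((2:ℝ≥0∞)⁻¹ ^ n) ^ 2) (n : ℕ) :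
    eHkNormSq α 4 (fs n) ≤ 2 * eHkNormSq α 4 F + 2 := by
  have hF4 : ContDiffOn ℝ 4 (uncurry F) strip := contDiffOn_infty.1 hA.smooth 4
  have hf4 : ContDiffOn ℝ 4 (uncurry (fs n)) strip := ((hA.test n).smooth 4).contDiffOn
  have hd4 : ContDiffOn ℝ 4 (uncurry (fs n - F)) strip := (hf4.sub hF4).congr fun p _ => rfl
  have e : eHkNormSq α 4 (fs n) = eHkNormSq α 4 (F + (fs n - F)) := eHkNormSq_congr_strip α 4 fun p _ => by simp
  rw [e]
  refine (eHkNormSq_add_le hF4 hd4).trans (add_le_add le_rfl ?_)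
  have h1 : eHkNormSq α 4 (fs n - F) ≤ 1 := (hfast n).trans (by
    calc ((2:ℝ≥0∞)⁻¹ ^ n) ^ 2 ≤ (1 ^ n) ^ 2 := by gcongr; norm_num
      _ = 1 := by simp)
  calc 2 * eHkNormSq α 4 (fs n - F) ≤ 2 * 1 := mul_le_mul' le_rfl h1
    _ = 2 := mul_one _

/-! ### Assembly: closure solutions are classical stream functions -/

/-- Iterated radial derivatives commute with the extension by zero (exactly). [folklore] -/
theorem Dz_stripExt (Ψ : ℝ → ℝ → ℝ) : Dz (stripExt Ψ) = stripExt (Dz Ψ) := by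
  funext z θ
  by_cases hθ : θ ∈ Ioo 0 (π / 2)
  · rw [stripExt_of_mem _ z hθ, Dz_apply, Dz_apply, radialSlice_stripExt Ψ hθ]
  · have e : (fun z' => stripExt Ψ z' θ) = fun _ => (0:ℝ) := funext fun z' => if_neg hθ
    rw [Dz_apply, e, deriv_const]
    simp [stripExt, hθ]

/-- `D_z^j(stripExt Ψ) = stripExt (D_z^jΨ)`. [folklore] -/
theorem iterate_Dz_stripExt (Ψ : ℝ → ℝ → ℝ) (j : ℕ) : Dz^[j] (stripExt Ψ) = stripExt (Dz^[j] Ψ) := by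
  induction j with
  | zero => rfl
  | succ j ih => rw [Function.iterate_succ_apply', Function.iterate_succ_apply', ih, Dz_stripExt]

/-- `∂_θθ(stripExt Ψ) = ∂_θθΨ` on the strip. [folklore] -/
theorem dθ_dθ_stripExt (Ψ : ℝ → ℝ → ℝ) {p : ℝ × ℝ} (hp : p ∈ strip) : dθ (dθ (stripExt Ψ)) p.1 p.2 = dθ (dθ Ψ) p.1 p.2 := by
  have hev : (fun θ' => dθ (stripExt Ψ) p.1 θ') =ᶠ[𝓝 p.2] fun θ' => dθ Ψ p.1 θ' := by
    filter_upwards [isOpen_Ioo.mem_nhds hp.2] with θ' hθ' using dθ_stripExt Ψ p.1 hθ'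
  exact hev.deriv_eq

/-- **Closure solutions of `L_αΨ = F` are classical stream functions with the Theorem 2 bounds.**
For `0 < α ≤ 1/4` and `F` in the `𝓗⁴`-closure of the test functions there is `Ψ`, smooth on the
strip, continuous on `(0,∞) × [0,π/2]` with `Ψ(R,0) = Ψ(R,π/2) = 0`, solving `L_αΨ = F`
(`IsStreamFunction α F Ψ`), with `L₁₂(F) ∈ C⁴(0,∞)`, the Theorem 2 bounds
`|∂_θθΨ + α⁻¹L₁₂(F) sin 2θ|² + |α²D_R²Ψ|² + |α²D_RΨ|² ≤ C|F|²` in `𝓗⁴`, and the local Hardy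
membership `Ψ²/sin²(2θ) ∈ L¹((a,b) × (0,π/2))`. [cite: Elgindi2021, §7.5 Theorem 2 with Remark 8.3 (pp. 24, 27) and §7 (p. 19) of arXiv:1904.04795] -/
theorem exists_isStreamFunction_of_hkApprox {α : ℝ} (hα : 0 < α) (hα4 : α ≤ 1 / 4) {F : ℝ → ℝ → ℝ} {fs : ℕ → ℝ → ℝ → ℝ}
    (hA : HkApprox α F fs) :
    ∃ Ψ : ℝ → ℝ → ℝ, ContDiffOn ℝ ∞ (uncurry Ψ) strip ∧ IsStreamFunction α F Ψ ∧ ContDiffOn ℝ 4 (L12 F) (Ioi 0) ∧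
      eHkNormSq α 4 (corrQ α Ψ (L12 F)) + eHkNormSq α 4 ((α ^ 2) • (Dz^[2] Ψ)) + eHkNormSq α 4 ((α ^ 2) • Dz Ψ) ≤
        thmTwoC * eHkNormSq α 4 F ∧
      ∀ a b : ℝ, 0 < a → a < b → IntegrableOn (fun p : ℝ × ℝ => Ψ p.1 p.2 ^ 2 / Real.sin (2 * p.2) ^ 2) (Ioo a b ×ˢ Ioo 0 (π / 2)) := by
  have hα1 : α ≤ 1 := hα4.trans (by norm_num)
  have hN : ∀ n, NiceDatum (fs n) := fun n => (hA.test n).niceDatum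
  choose U Ψr hS using fun n => exists_solData hα hα4 (hN n).contDiff_Fhat (hN n).hasCompactSupport_Fhat.1
    (hN n).hasCompactSupport_Fhat.2 (fun m hm _ => (hN n).Fhat_orth hm)
  obtain ⟨ns, hns, hfast⟩ := hA.exists_fast
  have hA' : HkApprox α F (fs ∘ ns) := hA.subseq hns
  obtain ⟨ΨL, G, D, hae⟩ := exists_thmTwoLimit_ae hA' (fun n => hS (ns n)) hfast
  set Ψ₀ : ℝ → ℝ → ℝ := fun R θ => ΨL (R, θ) with hΨ₀
  have hΨ₀s : ContDiffOn ℝ ∞ (uncurry Ψ₀) strip := D.limSmooth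
  have heq : ∀ p ∈ strip, ellipticOp α Ψ₀ p.1 p.2 = F p.1 p.2 := D.eqn
  have hL : ContDiffOn ℝ 4 (L12 F) (Ioi 0) := D.contDiffOn_L12
  have hbound := D.theoremTwo_limit_L12
  have hEF : eHkNormSq α 4 F < ⊤ := hA.eHkNormSq_lt_top
  have hfinC : thmTwoC * eHkNormSq α 4 F < ⊤ := ENNReal.mul_lt_top (lt_top_iff_ne_top.2 thmTwoC_ne_top) hEF
  -- finiteness of the `𝓗⁴` functional of `corrQ`
  have hcorr : eHkNormSq α 4 (corrQ α Ψ₀ (L12 F)) < ⊤ :=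
    lt_of_le_of_lt ((le_add_right le_rfl).trans (le_add_right le_rfl)) (hbound.trans_lt hfinC)
  have hcq : ContDiffOn ℝ 1 (uncurry (corrQ α Ψ₀ (L12 F))) strip := contDiffOn_corrQ (n := 1) hΨ₀s (hL.of_le (by norm_num))
  -- (h1), (h2): `∂_θθΨ₀, ∂_R∂_θθΨ₀ ∈ L²(box)` and integration from `π/4`
  have hL1 : ContDiffOn ℝ 1 (L12 F) (Ioi 0) := hL.of_le (by norm_num)
  have hLc : ContinuousOn (L12 F) (Ioi 0) := hL.continuousOn
  have hL'c : ContinuousOn (deriv (L12 F)) (Ioi 0) := (hL.deriv_of_isOpen (m := 0) isOpen_Ioi (by norm_num)).continuousOn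
  have hθθ : ∀ a b : ℝ, 0 < a → a < b → IntegrableOn (fun p : ℝ × ℝ => dθ (dθ Ψ₀) p.1 p.2 ^ 2) (Ioo a b ×ˢ Ioo 0 (π / 2)) := by
    intro a b ha hab
    have hq := integrableOn_sq_box_of_eHkNormSq α hcq.continuousOn hcorr (b := b) ha
    -- `∂_θθΨ₀ = corrQ − α⁻¹ L₁₂(F) sin 2θ`
    obtain ⟨M, hM⟩ : ∃ M, ∀ z ∈ Icc a b, |L12 F z| ≤ M := by
      obtain ⟨M, hM⟩ := isCompact_Icc.exists_bound_of_continuousOn (hLc.mono fun z hz => ha.trans_le hz.1)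
      exact ⟨M, fun z hz => by simpa [Real.norm_eq_abs] using hM z hz⟩
    have hc : ContinuousOn (fun p : ℝ × ℝ => dθ (dθ Ψ₀) p.1 p.2 ^ 2) (Ioo a b ×ˢ Ioo 0 (π / 2)) :=
      ((contDiffOn_dθ_strip (contDiffOn_dθ_strip hΨ₀s)).continuousOn.mono (qbox_subset_strip ha)).pow 2
    refine Integrable.mono' ((hq.const_mul 2).add (integrableOn_const (C := 2 * (α⁻¹ * M) ^ 2) ?_)) (hc.aestronglyMeasurable (measurableSet_qbox a b)) ?_
    · rw [Measure.volume_eq_prod, Measure.prod_prod, Real.volume_Ioo, Real.volume_Ioo]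
      exact (ENNReal.mul_lt_top ENNReal.ofReal_lt_top ENNReal.ofReal_lt_top).ne
    · rw [ae_restrict_iff' (measurableSet_qbox a b)]
      refine ae_of_all _ fun p hp => ?_
      rw [Real.norm_eq_abs, abs_of_nonneg (sq_nonneg _)]
      simp only [Pi.add_apply]
      have e : dθ (dθ Ψ₀) p.1 p.2 = corrQ α Ψ₀ (L12 F) p.1 p.2 - α⁻¹ * (L12 F p.1 * Real.sin (2 * p.2)) := by
        simp only [corrQ, Pi.add_apply, Pi.smul_apply, smul_eq_mul, tensor_apply, sin2]; ring
      rw [e]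
      have hLM := hM p.1 (Ioo_subset_Icc_self hp.1)
      have hs1 : |Real.sin (2 * p.2)| ≤ 1 := Real.abs_sin_le_one _
      have hy : |α⁻¹ * (L12 F p.1 * Real.sin (2 * p.2))| ≤ α⁻¹ * M := by
        rw [abs_mul, abs_mul, abs_of_pos (inv_pos.2 hα)]
        exact mul_le_mul_of_nonneg_left (by nlinarith [abs_nonneg (L12 F p.1), abs_nonneg (Real.sin (2 * p.2))]) (inv_pos.2 hα).le
      have hy2 : (α⁻¹ * (L12 F p.1 * Real.sin (2 * p.2))) ^ 2 ≤ (α⁻¹ * M) ^ 2 := by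
        rw [← sq_abs]; exact pow_le_pow_left₀ (abs_nonneg _) hy 2
      nlinarith [sq_nonneg (corrQ α Ψ₀ (L12 F) p.1 p.2 + α⁻¹ * (L12 F p.1 * Real.sin (2 * p.2)))]
  have hzθθ : ∀ a b : ℝ, 0 < a → a < b → IntegrableOn (fun p : ℝ × ℝ => dz (dθ (dθ Ψ₀)) p.1 p.2 ^ 2) (Ioo a b ×ˢ Ioo 0 (π / 2)) := by
    intro a b ha hab
    have hq := integrableOn_sq_dz_box_of_eHkNormSq α hcq hcorr (b := b) ha
    obtain ⟨M, hM⟩ : ∃ M, ∀ z ∈ Icc a b, |deriv (L12 F) z| ≤ M := by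
      obtain ⟨M, hM⟩ := isCompact_Icc.exists_bound_of_continuousOn (hL'c.mono fun z hz => ha.trans_le hz.1)
      exact ⟨M, fun z hz => by simpa [Real.norm_eq_abs] using hM z hz⟩
    have hsm : ContDiffOn ℝ ∞ (uncurry (dθ (dθ Ψ₀))) strip := contDiffOn_dθ_strip (contDiffOn_dθ_strip hΨ₀s)
    have hc : ContinuousOn (fun p : ℝ × ℝ => dz (dθ (dθ Ψ₀)) p.1 p.2 ^ 2) (Ioo a b ×ˢ Ioo 0 (π / 2)) :=
      ((contDiffOn_dz_strip hsm).continuousOn.mono (qbox_subset_strip ha)).pow 2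
    refine Integrable.mono' ((hq.const_mul 2).add (integrableOn_const (C := 2 * (α⁻¹ * M) ^ 2) ?_)) (hc.aestronglyMeasurable (measurableSet_qbox a b)) ?_
    · rw [Measure.volume_eq_prod, Measure.prod_prod, Real.volume_Ioo, Real.volume_Ioo]
      exact (ENNReal.mul_lt_top ENNReal.ofReal_lt_top ENNReal.ofReal_lt_top).ne
    · rw [ae_restrict_iff' (measurableSet_qbox a b)]
      refine ae_of_all _ fun p hp => ?_
      have hps : p ∈ strip := qbox_subset_strip ha hp
      rw [Real.norm_eq_abs, abs_of_nonneg (sq_nonneg _)]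
      simp only [Pi.add_apply]
      -- `∂_R corrQ = ∂_R∂_θθΨ₀ + α⁻¹ (L₁₂F)′ sin 2θ` at `p`
      have hd1 : HasDerivAt (fun z' => dθ (dθ Ψ₀) z' p.2) (dz (dθ (dθ Ψ₀)) p.1 p.2) p.1 :=
        hasDerivAt_radial_slice (contDiffOn_infty.1 hsm 1) hp.2 hps.1
      have hd2 : HasDerivAt (fun z' => α⁻¹ * (L12 F z' * sin2 p.2)) (α⁻¹ * (deriv (L12 F) p.1 * sin2 p.2)) p.1 := by
        have hdL : HasDerivAt (L12 F) (deriv (L12 F) p.1) p.1 :=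
          ((hL1.differentiableOn (by norm_num)).differentiableAt (Ioi_mem_nhds hps.1)).hasDerivAt
        exact (hdL.mul_const _).const_mul _
      have hsum := hd1.fun_add hd2
      have e : dz (corrQ α Ψ₀ (L12 F)) p.1 p.2 = dz (dθ (dθ Ψ₀)) p.1 p.2 + α⁻¹ * (deriv (L12 F) p.1 * sin2 p.2) := by
        have : (fun z' => corrQ α Ψ₀ (L12 F) z' p.2) = fun z' => dθ (dθ Ψ₀) z' p.2 + α⁻¹ * (L12 F z' * sin2 p.2) := by
          funext z'; simp only [corrQ, Pi.add_apply, Pi.smul_apply, smul_eq_mul, tensor_apply]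
        show deriv (fun z' => corrQ α Ψ₀ (L12 F) z' p.2) p.1 = _
        rw [this, hsum.deriv]
      have e' : dz (dθ (dθ Ψ₀)) p.1 p.2 = dz (corrQ α Ψ₀ (L12 F)) p.1 p.2 - α⁻¹ * (deriv (L12 F) p.1 * sin2 p.2) := by rw [e]; ring
      rw [e']
      have hLM := hM p.1 (Ioo_subset_Icc_self hp.1)
      have hs1 : |sin2 p.2| ≤ 1 := Real.abs_sin_le_one _
      have hy : |α⁻¹ * (deriv (L12 F) p.1 * sin2 p.2)| ≤ α⁻¹ * M := by
        rw [abs_mul, abs_mul, abs_of_pos (inv_pos.2 hα)]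
        exact mul_le_mul_of_nonneg_left (by nlinarith [abs_nonneg (deriv (L12 F) p.1), abs_nonneg (sin2 p.2)]) (inv_pos.2 hα).le
      have hy2 : (α⁻¹ * (deriv (L12 F) p.1 * sin2 p.2)) ^ 2 ≤ (α⁻¹ * M) ^ 2 := by
        rw [← sq_abs]; exact pow_le_pow_left₀ (abs_nonneg _) hy 2
      nlinarith [sq_nonneg (dz (corrQ α Ψ₀ (L12 F)) p.1 p.2 + α⁻¹ * (deriv (L12 F) p.1 * sin2 p.2))]
  have h1 : ∀ a b : ℝ, 0 < a → a < b → IntegrableOn (fun p : ℝ × ℝ => dθ Ψ₀ p.1 p.2 ^ 2) (Ioo a b ×ˢ Ioo 0 (π / 2)) :=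
    fun a b ha hab => integrableOn_sq_box_of_dθ (contDiffOn_dθ_strip hΨ₀s) ha (hθθ a b ha hab)
  have h2 : ∀ a b : ℝ, 0 < a → a < b → IntegrableOn (fun p : ℝ × ℝ => dz (dθ Ψ₀) p.1 p.2 ^ 2) (Ioo a b ×ˢ Ioo 0 (π / 2)) := by
    intro a b ha hab
    have hsm : ContDiffOn ℝ ∞ (uncurry (dz (dθ Ψ₀))) strip := contDiffOn_dz_strip (contDiffOn_dθ_strip hΨ₀s)
    refine integrableOn_sq_box_of_dθ hsm ha ((hzθθ a b ha hab).congr ?_)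
    rw [EventuallyEq, ae_restrict_iff' (measurableSet_qbox a b)]
    refine ae_of_all _ fun p hp => ?_
    have hps : p ∈ strip := qbox_subset_strip ha hp
    have h := dθ_dz_eq_dz_dθ (f := dθ Ψ₀) (contDiffOn_infty.1 (contDiffOn_dθ_strip hΨ₀s) 2) hps
    rw [h]
  -- (h3): the local Hardy membership by Fatou
  obtain ⟨hK0, hK⟩ := thmTwoK_spec
  set K' := ENNReal.ofReal thmTwoK
  have h3 : ∀ a b : ℝ, 0 < a → a < b → IntegrableOn (fun p : ℝ × ℝ => Ψ₀ p.1 p.2 ^ 2 / Real.sin (2 * p.2) ^ 2) (Ioo a b ×ˢ Ioo 0 (π / 2)) := by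
    intro a b ha hab
    set E := 2 * eHkNormSq α 4 F + 2 with hE
    set C : ℝ≥0∞ := 2 * (ENNReal.ofReal 160 * ((2 + 4 * (K' * 5)) * E)) +
        4 * (ENNReal.ofReal ((4 * α) ^ 2)⁻¹ * (2 * (5 * E)) * volume (Ioo a b ×ˢ Ioo (0:ℝ) (π / 2))) +
        4 * (ENNReal.ofReal (1 / 324) * (5 * E) * volume (Ioo (0:ℝ) (π / 2))) with hC
    have hbn : ∀ n, ∫⁻ p in Ioo a b ×ˢ Ioo (0:ℝ) (π / 2), ENNReal.ofReal (thmTwoSol α ((fs ∘ ns) n) (Ψr (ns n)) p.1 p.2 ^ 2 / Real.sin (2 * p.2) ^ 2) ≤ C := by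
      intro n
      have hf := hN (ns n)
      have hQn : eHkNormSq α 4 (fs (ns n)) ≤ E := eHkNormSq_fast_le hA' hfast n
      have hSn : ∑ j ∈ range 5, radialEnergy j (kMoment (fs (ns n))) ≤ 5 * E := (hf.sum_radialEnergy_kM_le α).trans (mul_le_mul' le_rfl hQn)
      have hA0 : radialEnergy 0 (kMoment (fs (ns n))) ≤ 5 * E :=
        (Finset.single_le_sum (f := fun j => radialEnergy j (kMoment (fs (ns n)))) (fun _ _ => by positivity) (Finset.mem_range.2 (by norm_num))).trans hSn
      have hFh : eHkNormSq α 4 (Fhat (fs (ns n))) ≤ (2 + 4 * (K' * 5)) * E := by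
        refine (hf.eHk_Fhat_le hK hα hα1).trans ?_
        calc 2 * eHkNormSq α 4 (fs (ns n)) + 4 * (K' * ∑ j ∈ range 5, radialEnergy j (kMoment (fs (ns n))))
            ≤ 2 * E + 4 * (K' * (5 * E)) := add_le_add (mul_le_mul' le_rfl hQn) (mul_le_mul' le_rfl (mul_le_mul' le_rfl hSn))
          _ = (2 + 4 * (K' * 5)) * E := by ring
      have hGb : radialEnergy 0 (Gbar α (fs (ns n))) ≤ ENNReal.ofReal (1 / 324) * (5 * E) :=
        (hf.radialEnergy_Gbar_le hα hα1 0).trans (mul_le_mul' le_rfl hA0)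
      refine (lintegral_box_hardy_thmTwoSol_le hf (hS (ns n)) ha).trans ?_
      simp only [hC]
      gcongr
    have hlim := lintegral_box_hardy_limit_le (Ψs := fun n => thmTwoSol α ((fs ∘ ns) n) (Ψr (ns n))) (Ψ := ΨL)
      (fun n => (D.solSmooth n).continuousOn) hae ha hbn
    have hCfin : C < ⊤ := by
      have hE' : E < ⊤ := by simp only [hE]; exact ENNReal.add_lt_top.2 ⟨ENNReal.mul_lt_top (by norm_num) hEF, by norm_num⟩
      have hv1 : volume (Ioo a b ×ˢ Ioo (0:ℝ) (π / 2)) < ⊤ := by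
        rw [Measure.volume_eq_prod, Measure.prod_prod, Real.volume_Ioo, Real.volume_Ioo]
        exact ENNReal.mul_lt_top ENNReal.ofReal_lt_top ENNReal.ofReal_lt_top
      have hv2 : volume (Ioo (0:ℝ) (π / 2)) < ⊤ := by rw [Real.volume_Ioo]; exact ENNReal.ofReal_lt_top
      have hK' : K' < ⊤ := ENNReal.ofReal_lt_top
      simp only [hC]
      refine ENNReal.add_lt_top.2 ⟨ENNReal.add_lt_top.2 ⟨?_, ?_⟩, ?_⟩
      · refine ENNReal.mul_lt_top (by norm_num) (ENNReal.mul_lt_top ENNReal.ofReal_lt_top (ENNReal.mul_lt_top ?_ hE'))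
        exact ENNReal.add_lt_top.2 ⟨by norm_num, ENNReal.mul_lt_top (by norm_num) (ENNReal.mul_lt_top hK' (by norm_num))⟩
      · exact ENNReal.mul_lt_top (by norm_num) (ENNReal.mul_lt_top (ENNReal.mul_lt_top ENNReal.ofReal_lt_top
          (ENNReal.mul_lt_top (by norm_num) (ENNReal.mul_lt_top (by norm_num) hE'))) hv1)
      · exact ENNReal.mul_lt_top (by norm_num) (ENNReal.mul_lt_top (ENNReal.mul_lt_top ENNReal.ofReal_lt_top (ENNReal.mul_lt_top (by norm_num) hE')) hv2)
    have hc : ContinuousOn (uncurry fun R θ => Ψ₀ R θ / Real.sin (2 * θ)) strip := by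
      refine ContinuousOn.div hΨ₀s.continuousOn (by fun_prop) fun p hp => ?_
      exact (Real.sin_pos_of_pos_of_lt_pi (by linarith [hp.2.1]) (by linarith [hp.2.2])).ne'
    have hint := integrableOn_sq_box_of_lintegral hc ha (b := b) (lt_of_le_of_lt (le_of_eq (lintegral_congr fun p => by simp [hΨ₀, div_pow])) (hlim.trans_lt hCfin))
    exact hint.congr (ae_of_all _ fun p => by simp [div_pow])
  -- the classical stream function
  refine ⟨stripExt Ψ₀, contDiffOn_stripExt hΨ₀s, isStreamFunction_stripExt hΨ₀s h1 h2 h3 α heq, hL, ?_, ?_⟩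
  · have e1 : eHkNormSq α 4 (corrQ α (stripExt Ψ₀) (L12 F)) = eHkNormSq α 4 (corrQ α Ψ₀ (L12 F)) :=
      eHkNormSq_congr_strip α 4 fun p hp => by
        simp only [corrQ, Pi.add_apply, Pi.smul_apply, smul_eq_mul, tensor_apply, dθ_dθ_stripExt Ψ₀ hp]
    have e2 : eHkNormSq α 4 ((α ^ 2) • (Dz^[2] (stripExt Ψ₀))) = eHkNormSq α 4 ((α ^ 2) • (Dz^[2] Ψ₀)) :=
      eHkNormSq_congr_strip α 4 fun p hp => by
        simp only [Pi.smul_apply, smul_eq_mul, iterate_Dz_stripExt, stripExt_of_mem _ p.1 hp.2]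
    have e3 : eHkNormSq α 4 ((α ^ 2) • Dz (stripExt Ψ₀)) = eHkNormSq α 4 ((α ^ 2) • Dz Ψ₀) :=
      eHkNormSq_congr_strip α 4 fun p hp => by
        simp only [Pi.smul_apply, smul_eq_mul, Dz_stripExt, stripExt_of_mem _ p.1 hp.2]
    rw [e1, e2, e3]; exact hbound
  · intro a b ha hab
    refine (h3 a b ha hab).congr ?_
    rw [EventuallyEq, ae_restrict_iff' (measurableSet_qbox a b)]
    exact ae_of_all _ fun p hp => by rw [stripExt_of_mem _ p.1 hp.2]

/-- **Closure solutions for strip-smooth data of finite `𝓗⁴` functional and finite `γ`-words.** [cite: Elgindi2021, §7.5 Theorem 2 with Remark 8.3 (pp. 24, 27) and §7 (p. 19) of arXiv:1904.04795] -/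
theorem exists_isStreamFunction_of_finite {α : ℝ} (hα : 0 < α) (hα4 : α ≤ 1 / 4) {F : ℝ → ℝ → ℝ}
    (hF : ContDiffOn ℝ ∞ (uncurry F) strip) (hE : eHkNormSq α 4 F < ⊤) (hH : gammaWords α F < ⊤) :
    ∃ Ψ : ℝ → ℝ → ℝ, ContDiffOn ℝ ∞ (uncurry Ψ) strip ∧ IsStreamFunction α F Ψ ∧ ContDiffOn ℝ 4 (L12 F) (Ioi 0) ∧
      eHkNormSq α 4 (corrQ α Ψ (L12 F)) + eHkNormSq α 4 ((α ^ 2) • (Dz^[2] Ψ)) + eHkNormSq α 4 ((α ^ 2) • Dz Ψ) ≤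
        thmTwoC * eHkNormSq α 4 F ∧
      ∀ a b : ℝ, 0 < a → a < b → IntegrableOn (fun p : ℝ × ℝ => Ψ p.1 p.2 ^ 2 / Real.sin (2 * p.2) ^ 2) (Ioo a b ×ˢ Ioo 0 (π / 2)) :=
  exists_isStreamFunction_of_hkApprox hα hα4 (hkApprox_cutFun α hF hE hH)

end Elgindi

end Literature.Analysis.FluidPDE
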